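import Literature.NumberTheory.Automorphic.LocalLanglandsGL
import Literature.NumberTheory.Automorphic.LocalLanglandsGLProofs
import Literature.NumberTheory.Automorphic.GKModulesAdmissible

/-!
# The quadratic relabelling of the one-dimensional classes of `GL₂(F)` (part 1 of the negative
lemma "reciprocity data are not rigid" for crux `ReciprocityUpToIrreducibilityR`, stmt-Langlands-17925)

Refuter seat `refuter-cdisprove-stmt-Langlands-17925-0` (crux disprover), route
`IrreducibilityBySelfDuality`.  Part 1 (this file, local and datum-free): the `det`-character classes
`[χ ∘ det]` of `Irr(GL_n(F))` (`detCharIrrep`, `ActsByDet`, `IsDetChar`), their non-genericity for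
`n = 2` (`not_isGeneric_of_actsByDet`), and the relabelling `swap η` of `Irr(GL_n(F))` — twist the
`det`-character classes of `GL₂(F)` by `η ∘ det`, fix everything else — with the four properties the
six clauses of `IsLocalLanglandsGL` need: it fixes generic classes (`swap_mk_of_isGeneric`), commutes
with twists (`swap_twist`), and is an involution, hence bijective, when `η² = 1` (`swap_bijective`).
Part 2 (`ReciprocityDataNotRigid`) builds the sibling datum and the `ReciprocityData` statements.
No `sorry`; axioms standard.
-/

noncomputable section

open scoped MatrixGroups
open Literature.NumberTheory.Automorphic Literature.NumberTheory.GaloisRepresentations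

namespace Summit.Langlands.Langlands.Theorems.ReciprocityUpToIrreducibilityR.Negative

set_option linter.dupNamespace false

/-! ### Bookkeeping on bundled irreducible smooth representations -/

section SmoothIrrepLemmas

variable {G : Type*} [Group G] [TopologicalSpace G]

/-- Two bundled irreducible smooth representations on the same space with equal actions are equal
(the remaining fields are propositions). [folklore] -/
theorem smoothIrrep_mk_eq_mk {V : Type} [AddCommGroup V] [Module ℂ V]
    {ρ ρ' : Representation ℂ G V} (h : ρ = ρ') (p : ρ.IsIrreducible) (q : ρ.IsSmooth)
    (p' : ρ'.IsIrreducible) (q' : ρ'.IsSmooth) :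
    (⟨V, ρ, p, q⟩ : SmoothIrrep G) = ⟨V, ρ', p', q'⟩ := by
  subst h; rfl

variable [SeparatelyContinuousMul G]

/-- The kernel of a product of characters with open kernels is open. [folklore] -/
theorem isOpen_ker_mul {c c' : G →* ℂˣ} (hc : IsOpen (c.ker : Set G))
    (hc' : IsOpen (c'.ker : Set G)) : IsOpen ((c * c').ker : Set G) := by
  have h : IsOpen ((c.ker ⊓ c'.ker : Subgroup G) : Set G) := by
    rw [Subgroup.coe_inf]; exact hc.inter hc'
  refine Subgroup.isOpen_mono ?_ h
  intro g hg
  simp only [Subgroup.mem_inf, MonoidHom.mem_ker] at hg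
  rw [MonoidHom.mem_ker, MonoidHom.mul_apply, hg.1, hg.2, one_mul]

/-- Iterated twists: `(π ⊗ c) ⊗ c' = π ⊗ (c c')` as bundled representations. [folklore] -/
theorem twist_twist (π : SmoothIrrep G) (c c' : G →* ℂˣ) (hc : IsOpen (c.ker : Set G))
    (hc' : IsOpen (c'.ker : Set G)) :
    (π.twist c hc).twist c' hc' = π.twist (c * c') (isOpen_ker_mul hc hc') :=
  smoothIrrep_mk_eq_mk (Representation.twist_twist π.ρ c c') _ _ _ _

/-- Twisting by the trivial character does nothing. [folklore] -/
theorem twist_one (π : SmoothIrrep G) (h : IsOpen ((1 : G →* ℂˣ).ker : Set G)) :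
    π.twist 1 h = π :=
  smoothIrrep_mk_eq_mk (Representation.twist_one π.ρ) _ _ _ _

/-- Twists by characters commute. [folklore] -/
theorem twist_comm (π : SmoothIrrep G) (c c' : G →* ℂˣ) (hc : IsOpen (c.ker : Set G))
    (hc' : IsOpen (c'.ker : Set G)) :
    (π.twist c hc).twist c' hc' = (π.twist c' hc').twist c hc := by
  rw [twist_twist, twist_twist]
  exact smoothIrrep_mk_eq_mk (by rw [show c * c' = c' * c from MonoidHom.ext fun _ => mul_comm _ _])
    _ _ _ _

/-- Twisting twice by a character of order `≤ 2` does nothing. [folklore] -/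
theorem twist_twist_of_mul_self (π : SmoothIrrep G) {c : G →* ℂˣ} (hc : IsOpen (c.ker : Set G))
    (h : c * c = 1) : (π.twist c hc).twist c hc = π := by
  have h1 : IsOpen ((1 : G →* ℂˣ).ker : Set G) := h ▸ isOpen_ker_mul hc hc
  rw [twist_twist]
  have h2 : π.twist (c * c) (isOpen_ker_mul hc hc) = π.twist 1 h1 :=
    smoothIrrep_mk_eq_mk (by rw [h]) _ _ _ _
  rw [h2, twist_one]

end SmoothIrrepLemmas

/-! ### One-dimensional classes `χ ∘ det` of `GL_n(F)` -/

section DetChar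

variable {F : Type} [Field F] [ValuativeRel F] [TopologicalSpace F] [IsNonarchimedeanLocalField F]

omit [ValuativeRel F] [IsNonarchimedeanLocalField F] in
/-- The one-dimensional representation `g ↦ χ(det g)` of `GL_n(F)` on `ℂ`. [folklore] -/
def detCharRep (n : ℕ) (χ : QuasiChar F) : Representation ℂ (GL (Fin n) F) ℂ where
  toFun g := ((χ (Matrix.GeneralLinearGroup.det g) : ℂˣ) : ℂ) • LinearMap.id
  map_one' := by ext; simp
  map_mul' g h := by ext; simp [mul_comm]

omit [ValuativeRel F] [IsNonarchimedeanLocalField F] in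
/-- `detCharRep n χ g` is multiplication by `χ(det g)`. [folklore] -/
@[simp] theorem detCharRep_apply (n : ℕ) (χ : QuasiChar F) (g : GL (Fin n) F) (z : ℂ) :
    detCharRep n χ g z = ((χ (Matrix.GeneralLinearGroup.det g) : ℂˣ) : ℂ) * z := rfl

/-- The irreducible smooth representation `χ ∘ det` of `GL_n(F)` attached to a quasi-character
(smooth because quasi-characters have open kernel, `isOpen_ker_quasiChar_holds`). [folklore] -/
def detCharIrrep (n : ℕ) (χ : QuasiChar F) : SmoothIrrep (GL (Fin n) F) where
  V := ℂ
  ρ := detCharRep n χ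
  isIrreducible := isIrreducible_of_finrank_eq_one' _ (Module.finrank_self ℂ)
  isSmooth := by
    intro v
    refine Subgroup.isOpen_mono ?_ (isOpen_ker_charDet n (isOpen_ker_quasiChar_holds χ))
    intro g hg
    rw [MonoidHom.mem_ker, charDet_apply] at hg
    rw [Representation.mem_stabilizerSubgroup]
    change ((χ (Matrix.GeneralLinearGroup.det g) : ℂˣ) : ℂ) * v = v
    rw [hg, Units.val_one, one_mul]

/-- `π` **acts through `χ ∘ det`**: `π(g) v = χ(det g) v`. [folklore] -/
def ActsByDet {n : ℕ} (π : SmoothIrrep (GL (Fin n) F)) (χ : QuasiChar F) : Prop :=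
  ∀ (g : GL (Fin n) F) (v : π.V), π.ρ g v = ((χ (Matrix.GeneralLinearGroup.det g) : ℂˣ) : ℂ) • v

/-- `detCharIrrep n χ` acts through `χ ∘ det` (by definition). [folklore] -/
theorem actsByDet_detCharIrrep (n : ℕ) (χ : QuasiChar F) : ActsByDet (detCharIrrep n χ) χ :=
  fun _ _ => rfl

omit [ValuativeRel F] [IsNonarchimedeanLocalField F] in
/-- `ActsByDet` transports along isomorphisms of representations. [folklore] -/
theorem ActsByDet.transport {n : ℕ} {π π' : SmoothIrrep (GL (Fin n) F)} (e : π.ρ.Equiv π'.ρ)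
    {χ : QuasiChar F} (h : ActsByDet π χ) : ActsByDet π' χ := by
  intro g v'
  obtain ⟨v, rfl⟩ := e.toLinearEquiv.surjective v'
  have h1 := e.toIntertwiningMap.isIntertwining π.ρ π'.ρ g v
  rw [Representation.Equiv.coe_toIntertwiningMap] at h1
  rw [Representation.Equiv.toLinearEquiv_apply, Representation.Equiv.coe_toIntertwiningMap, ← h1,
    h g v, map_smul]

omit [ValuativeRel F] [IsNonarchimedeanLocalField F] in
/-- Pointwise product of quasi-characters. [folklore] -/
theorem quasiChar_mul_apply (χ η : QuasiChar F) (x : Fˣ) : (χ * η) x = χ x * η x := rfl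

omit [ValuativeRel F] [IsNonarchimedeanLocalField F] in
/-- Pointwise inverse of a quasi-character. [folklore] -/
theorem quasiChar_inv_apply (η : QuasiChar F) (x : Fˣ) : η⁻¹ x = (η x)⁻¹ := rfl

/-- Twisting `χ ∘ det` by `η ∘ det` gives `(χη) ∘ det`. [folklore] -/
theorem ActsByDet.twist {n : ℕ} {π : SmoothIrrep (GL (Fin n) F)} {χ : QuasiChar F}
    (h : ActsByDet π χ) (η : QuasiChar F) (hη : IsOpen ((charDet n η).ker : Set (GL (Fin n) F))) :
    ActsByDet (π.twist (charDet n η) hη) (χ * η) := by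
  change ∀ (g : GL (Fin n) F) (v : π.V), ((charDet n η g : ℂˣ) : ℂ) • π.ρ g v =
    (((χ * η) (Matrix.GeneralLinearGroup.det g) : ℂˣ) : ℂ) • v
  intro g v
  rw [h g v, charDet_apply, smul_smul, quasiChar_mul_apply, Units.val_mul, mul_comm]

/-- Conversely, if a twist by `η ∘ det` acts through `χ ∘ det` then `π` acts through
`(χ η⁻¹) ∘ det`. [folklore] -/
theorem ActsByDet.of_twist {n : ℕ} {π : SmoothIrrep (GL (Fin n) F)} {χ : QuasiChar F}
    (η : QuasiChar F) (hη : IsOpen ((charDet n η).ker : Set (GL (Fin n) F)))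
    (h : ActsByDet (π.twist (charDet n η) hη) χ) : ActsByDet π (χ * η⁻¹) := by
  intro g v
  have h1 : ((charDet n η g : ℂˣ) : ℂ) • π.ρ g v =
      ((χ (Matrix.GeneralLinearGroup.det g) : ℂˣ) : ℂ) • v := h g v
  rw [charDet_apply] at h1
  have ha : ((η (Matrix.GeneralLinearGroup.det g) : ℂˣ) : ℂ) ≠ 0 := Units.ne_zero _
  calc π.ρ g v = ((η (Matrix.GeneralLinearGroup.det g) : ℂˣ) : ℂ)⁻¹ •
        (((η (Matrix.GeneralLinearGroup.det g) : ℂˣ) : ℂ) • π.ρ g v) := by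
          rw [smul_smul, inv_mul_cancel₀ ha, one_smul]
    _ = (((χ * η⁻¹) (Matrix.GeneralLinearGroup.det g) : ℂˣ) : ℂ) • v := by
          rw [h1, smul_smul, quasiChar_mul_apply, quasiChar_inv_apply, Units.val_mul,
            Units.val_inv_eq_inv_val, mul_comm]

/-- A class of `Irr(GL_n(F))` **is a `det`-character class**: some (every) representative acts
through `χ ∘ det` for some quasi-character `χ`. [folklore] -/
def IsDetChar {n : ℕ} : IrrClass (GL (Fin n) F) → Prop :=
  IrrClass.liftProp (fun π => ∃ χ : QuasiChar F, ActsByDet π χ)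
    (fun _ _ e h => h.elim fun χ hχ => ⟨χ, hχ.transport e⟩)

omit [ValuativeRel F] [IsNonarchimedeanLocalField F] in
/-- Computation rule for `IsDetChar` on a class `[π]`. [folklore] -/
@[simp] theorem isDetChar_mk {n : ℕ} (π : SmoothIrrep (GL (Fin n) F)) :
    IsDetChar (IrrClass.mk π) ↔ ∃ χ : QuasiChar F, ActsByDet π χ := Iff.rfl

omit [ValuativeRel F] [TopologicalSpace F] [IsNonarchimedeanLocalField F] in
/-- `n(x) = (1 x; 0 1) ∈ U₂(F)`. [folklore] -/
theorem upperRightHom_mem (x : F) :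
    (Matrix.GeneralLinearGroup.upperRightHom x : GL (Fin 2) F) ∈ upperUnitriangular (Fin 2) F := by
  rw [mem_upperUnitriangular_iff, Matrix.GeneralLinearGroup.upperRightHom_apply]
  refine ⟨fun i j hij => ?_, fun i => ?_⟩
  · fin_cases i <;> fin_cases j <;> simp at hij ⊢
  · fin_cases i <;> simp

omit [ValuativeRel F] [TopologicalSpace F] [IsNonarchimedeanLocalField F] in
/-- `ψ_U(n(x)) = ψ(x)`. [folklore] -/
theorem whittakerCharFun_upperRightHom (ψ : AddChar F Circle) (x : F) :
    whittakerCharFun ψ ⟨_, upperRightHom_mem x⟩ = ((ψ x : Circle) : ℂ) := by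
  rw [whittakerCharFun_apply, superdiagSum_def, Fin.sum_univ_two, Fin.sum_univ_two, Fin.sum_univ_two]
  simp [Matrix.GeneralLinearGroup.upperRightHom_apply]

omit [ValuativeRel F] [IsNonarchimedeanLocalField F] in
/-- **One-dimensional classes of `GL₂(F)` are not generic** (for any additive character that is
not identically `1`): `U₂` acts trivially (`det u = 1`) while `ψ_U(n(x)) = ψ(x) ≠ 1`. [folklore] -/
theorem not_isGeneric_of_actsByDet {π : SmoothIrrep (GL (Fin 2) F)} {χ : QuasiChar F}
    (h : ActsByDet π χ) {ψ : AddChar F Circle} (hψ : ∃ x, ψ x ≠ 1) : ¬ IsGeneric π.ρ ψ := by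
  refine not_isGeneric_of_upperUnitriangular_le_ker (fun u => ?_) ?_
  · refine LinearMap.ext fun v => ?_
    rw [h, det_eq_one_of_mem_upperUnitriangular u.2, map_one, Units.val_one, one_smul,
      Module.End.one_apply]
  · obtain ⟨x, hx⟩ := hψ
    refine ⟨⟨_, upperRightHom_mem x⟩, ?_⟩
    rw [whittakerCharFun_upperRightHom]
    exact fun h' => hx (Circle.coe_inj.1 (h'.trans Circle.coe_one.symm))

end DetChar

/-! ### The relabelling: twist the `det`-character classes of `GL₂(F)` by a fixed `η` -/

section Swap

variable {F : Type} [Field F] [ValuativeRel F] [TopologicalSpace F] [IsNonarchimedeanLocalField F]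
  (η : QuasiChar F)

/-- `η ∘ det` has open kernel (quasi-characters are smooth). [folklore] -/
theorem isOpen_ker_charDet_quasiChar (n : ℕ) : IsOpen ((charDet n η).ker : Set (GL (Fin n) F)) :=
  isOpen_ker_charDet n (isOpen_ker_quasiChar_holds η)

open Classical in
/-- On `Irr(GL₂(F))`: twist the `det`-character classes by `η ∘ det`, fix every other class. -/
def swapClass (c : IrrClass (GL (Fin 2) F)) : IrrClass (GL (Fin 2) F) :=
  if IsDetChar c then IrrClass.twist (charDet 2 η) (isOpen_ker_charDet_quasiChar η 2) c else c

/-- The relabelling in all ranks: `swapClass η` in rank `2`, the identity elsewhere. -/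
def swap : (n : ℕ) → IrrClass (GL (Fin n) F) → IrrClass (GL (Fin n) F)
  | 2 => swapClass η
  | _ => id

/-- In rank `2` the relabelling is `swapClass η`. [folklore] -/
theorem swap_two : swap η 2 = swapClass η := rfl

/-- In every rank `n ≠ 2` the relabelling is the identity. [folklore] -/
theorem swap_of_ne_two {n : ℕ} (hn : n ≠ 2) : swap η n = id := by
  match n, hn with
  | 0, _ => rfl
  | 1, _ => rfl
  | 2, h => exact absurd rfl h
  | n + 3, _ => rfl

/-- On a `det`-character class the relabelling is the twist by `η ∘ det`. [folklore] -/
theorem swapClass_mk_of_actsByDet {π : SmoothIrrep (GL (Fin 2) F)} {χ : QuasiChar F}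
    (h : ActsByDet π χ) :
    swapClass η (IrrClass.mk π) = IrrClass.mk (π.twist (charDet 2 η) (isOpen_ker_charDet_quasiChar η 2)) :=
  if_pos ⟨χ, h⟩

/-- Off the `det`-character classes the relabelling is the identity. [folklore] -/
theorem swapClass_of_not {c : IrrClass (GL (Fin 2) F)} (h : ¬ IsDetChar c) : swapClass η c = c :=
  if_neg h

/-- `swapClass η` fixes every generic class. [folklore] -/
theorem swapClass_mk_of_isGeneric (π : SmoothIrrep (GL (Fin 2) F)) {ψ : AddChar F Circle}
    (hψ : ∃ x, ψ x ≠ 1) (hg : IsGeneric π.ρ ψ) : swapClass η (IrrClass.mk π) = IrrClass.mk π :=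
  swapClass_of_not η fun ⟨_, h⟩ => not_isGeneric_of_actsByDet h hψ hg

/-- `swap η n` fixes every generic class, in every rank. [folklore] -/
theorem swap_mk_of_isGeneric {n : ℕ} (π : SmoothIrrep (GL (Fin n) F)) {ψ : AddChar F Circle}
    (hψ : ∃ x, ψ x ≠ 1) (hg : IsGeneric π.ρ ψ) : swap η n (IrrClass.mk π) = IrrClass.mk π := by
  rcases eq_or_ne n 2 with rfl | hn
  · exact swapClass_mk_of_isGeneric η π hψ hg
  · rw [swap_of_ne_two η hn, id]

/-- `swapClass η` commutes with twisting by any `χ' ∘ det`. [folklore] -/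
theorem swapClass_twist (χ' : QuasiChar F) (hχ' : IsOpen ((charDet 2 χ').ker : Set (GL (Fin 2) F)))
    (c : IrrClass (GL (Fin 2) F)) :
    swapClass η (IrrClass.twist (charDet 2 χ') hχ' c) =
      IrrClass.twist (charDet 2 χ') hχ' (swapClass η c) := by
  induction c using IrrClass.ind with
  | h π =>
    rw [IrrClass.twist_mk]
    by_cases hd : ∃ χ : QuasiChar F, ActsByDet π χ
    · obtain ⟨χ, hχ⟩ := hd
      rw [swapClass_mk_of_actsByDet η (hχ.twist χ' hχ'), swapClass_mk_of_actsByDet η hχ,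
        IrrClass.twist_mk, twist_comm]
    · have hd' : ¬ IsDetChar (IrrClass.mk (π.twist (charDet 2 χ') hχ')) :=
        fun ⟨χ, hχ⟩ => hd ⟨_, hχ.of_twist χ' hχ'⟩
      rw [swapClass_of_not η hd', swapClass_of_not η (c := IrrClass.mk π) hd, IrrClass.twist_mk]

/-- `swap η n` commutes with twisting by any `χ' ∘ det`, in every rank. [folklore] -/
theorem swap_twist {n : ℕ} (χ' : QuasiChar F) (hχ' : IsOpen ((charDet n χ').ker : Set (GL (Fin n) F)))
    (c : IrrClass (GL (Fin n) F)) :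
    swap η n (IrrClass.twist (charDet n χ') hχ' c) = IrrClass.twist (charDet n χ') hχ' (swap η n c) := by
  rcases eq_or_ne n 2 with rfl | hn
  · exact swapClass_twist η χ' hχ' c
  · rw [swap_of_ne_two η hn, id, id]

variable (hη2 : ∀ x, η x * η x = 1)
include hη2

omit [ValuativeRel F] [IsNonarchimedeanLocalField F] in
/-- `(η ∘ det)² = 1` when `η² = 1`. [folklore] -/
theorem charDet_mul_self_eq_one (n : ℕ) : charDet n η * charDet n η = 1 := by
  refine MonoidHom.ext fun g => ?_
  rw [MonoidHom.mul_apply, MonoidHom.one_apply, charDet_apply]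
  exact hη2 _

/-- For `η² = 1`, `swapClass η` is an involution. [folklore] -/
theorem swapClass_swapClass (c : IrrClass (GL (Fin 2) F)) : swapClass η (swapClass η c) = c := by
  induction c using IrrClass.ind with
  | h π =>
    by_cases hd : ∃ χ : QuasiChar F, ActsByDet π χ
    · obtain ⟨χ, hχ⟩ := hd
      rw [swapClass_mk_of_actsByDet η hχ, swapClass_mk_of_actsByDet η (hχ.twist η _),
        twist_twist_of_mul_self π _ (charDet_mul_self_eq_one η hη2 2)]
    · rw [swapClass_of_not η (c := IrrClass.mk π) hd, swapClass_of_not η (c := IrrClass.mk π) hd]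

/-- For `η² = 1`, every `swap η n` is a bijection. [folklore] -/
theorem swap_bijective (n : ℕ) : Function.Bijective (swap η n) := by
  rcases eq_or_ne n 2 with rfl | hn
  · exact Function.Involutive.bijective (swapClass_swapClass η hη2)
  · rw [swap_of_ne_two η hn]
    exact Function.bijective_id

end Swap

end Summit.Langlands.Langlands.Theorems.ReciprocityUpToIrreducibilityR.Negative

end
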